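import Summits.BirchSwinnertonDyer.BirchSwinnertonDyer.Theses.UniversalToricDescent
import Summits.BirchSwinnertonDyer.BirchSwinnertonDyer.Theorems.UniversalToricDescentToricTransportModThreeStubRatSqueeze
import Summits.BirchSwinnertonDyer.BirchSwinnertonDyer.Theorems.UniversalToricDescentTorsionMuTransportHeegner
import Summits.BirchSwinnertonDyer.BirchSwinnertonDyer.Theorems.UniversalToricDescentRationalSplitIMCInclusionAtThreeOfWall
import Summits.BirchSwinnertonDyer.Rank1Residual.WAll.TargetAdditiveAtThreeWildLocalTypeSlices
import Literature.NumberTheory.EllipticCurves.Fisher2012.HessePencilThreeClosedForms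
import HarnessLib

/-!
# NODE `heegner_pencil_sieve` — crux `AdditiveSplitIMCInclusionAtThree` (stmt-BirchSwinnertonDyer-20395, THE WALL, UTD r201)
# crux-ideate STANDING COVER round 15 (unit cruxidea-stmt-BirchSwinnertonDyer-20395-1-g15), 2026-08-31

D-0171 NODE with children. THE LEVER (new on this crux): the `K`-ADAPTED TWIN, supplied by ARITHMETIC STATISTICS
ON THE TWO HESSE PENCILS. The wall quantifies over EVERY imaginary quadratic `K` Heegner for `N(E)`; the route's
rational road (`RationalSplitIMCInclusionAtThree`, item 24207) plus a twin `E′ ≡ E (mod 3)` with algebraic `μ = 0`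
gives the wall ONLY when `N(E′)` is Heegner for the SAME `K` (landed transport `torsionMuTransportModThree` consumes
`SatisfiesHeegnerHypothesis N K` AND `SatisfiesHeegnerHypothesis N′ K`: a bad prime of `E′` inert in `K` splits
completely in `K_∞^{ac}` and feeds `μ`). Node `ratwall_twin_transport` (g6) named this surplus «(S2)» and left it
UNDECIDED; node `serre_source_transport` (g14) dissolved it only on the stratum `N(ρ̄) = level of an optimal form`.
HERE (S2) is dissolved on the whole semistable-type cell:

* the twists of `E` with `E′[3] ≅ E[3]` are the members of `X_E(3) ≅ ℙ¹` (symplectic) and `X_E⁻(3) ≅ ℙ¹`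
  (anti-symplectic) — Fisher 2012 Thm 13.2 and its §13 reverse analogue, BOTH PROVED in the tree
  (`Fisher2012.thm132_threeCongruent_hessePencil_holds`, `Fisher2012.thm132rev_threeCongruent_dualHessePencil_holds`);
  members `E_{l,m} = hessePencil3 c₄ c₆ l m`, `E⁻_{l,m} = dualHessePencil3 c₄ c₆ l m`;
* `Δ(E_{l,m}) = 2⁶3⁹Δ′·𝔇(l,m)³` (tree: `Fisher2012.Δ_hessePencil3`) and `Δ(E⁻_{l,m})·Δ′⁴ = −3⁹·𝔠₄(l,m)³`
  (`Δ_dualHessePencil3` below, kernel-checked from the tree's syzygy), `Δ′ = c₄³ − c₆² = 1728Δ_E`, with Fisher's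
  two integral binary QUARTICS `𝔇 = (1, 0, −6c₄, −8c₆, −3c₄²)` and `𝔠₄ = (c₄, 4c₆, 6c₄², 4c₄c₆, 4c₆² − 3c₄³)`
  (anchors `binQuartic_hesseDCoeffs_cast`, `binQuartic_hesseC4Coeffs_cast`); hence EVERY bad prime of a member
  outside `S = {2,3} ∪ {p ∣ N}` divides `F(l,m)`, `F ∈ {𝔇, 𝔠₄}`;
* so «a twin of route class whose conductor is Heegner for `K`» = «a coprime `(l,m)` in a congruence class
  `mod 2^j3^k` (3-adically: a disc around a route-class `ℚ₃`-point of `X_E^±(3)`; 2-adically: a good-reduction disc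
  when `2 ∤ N`) ALL of whose `F`-prime factors outside `S` SPLIT in `K`» (`GoodParameter`) — a problem of analytic
  number theory about the values of an irreducible, indefinite binary quartic form: the `χ_K`-twisted divisor sums
  `Σ_{(l,m)} r_K(F(l,m))` over binary QUARTICS are exactly the frontier of Daniel's level of distribution (Greaves
  `d = 3`, Daniel `d = 4`, "when `d ≥ 5` there are no binary forms for which an asymptotic formula is known" —
  de la Bretèche–Browning, Acta Arith. 125 (2006), p. 3), settled for `K = ℚ(i)` by de la Bretèche–Tenenbaum
  (J. Inst. Math. Jussieu 12 (2013), Thm 1.1–1.2: `F` irreducible over `ℚ[i]`; general imaginary quadratic `K`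
  "plus délicate mais abordable par la même approche", p. 3). Degree `4 = #ℙ¹(𝔽₃)` (the four cusps): the lever is
  specific to `p = 3` (for `p = 5` the cusp form is a binary form of degree 12).
* RECIPROCITY PROVISO (why A1 carries «indefinite»): if every prime of `F(l,m)` outside `S` splits then
  `∏_{v ∈ S ∪ ram(K) ∪ {∞}} (d_K, F(l,m))_v = +1`; for a DEFINITE quartic this sign is constant on fine classes and can
  be `−1` (e.g. `a = (1,0,0,0,2)`, `K = ℚ(i)`, `S = {2,3}`, class `(9,1) mod 24`: `F ≡ 3 (mod 8)`, `3 ∤ F`, so every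
  value has a prime `≡ 3 (mod 4)`; `F(9,1) = 6563` is such a prime). `K` imaginary and `F` INDEFINITE ⇒ both signs
  occur in every class (move in `ℙ¹(ℝ)` at fixed finite classes), so there is no reciprocity obstruction; `𝔇` and
  `𝔠₄` are indefinite because complex conjugation (`det ρ̄(c) = −1` = an odd involution of the four cusps, i.e. a
  transposition in `PGL₂(𝔽₃) ≅ S₄`) fixes exactly two cusps.

INSTRUMENT (F-g15-pencil, this unit, pure python, `instr/pencil_sieve_g15.py`; cell classes = wild `O6` at 3,
`ρ̄₃` onto, `r_an = 1`; `K` = least Heegner `d_K` with 3 split; box `|l|,|m| ≤ 30`, 1111 coprime parameters each):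
K-ADAPTED members (every new bad prime split in `K`, all multiplicative): 135378c1 (`d_K = −143`) 227 = 20.4 %,
125550cs1 (−119) 154 = 13.9 %, 111510cj1 (−719) 250 = 22.5 %, 143154j1 (−239) 260 = 23.4 %, 134946bz1 (−47)
179 = 16.1 %, 131760c1 (−119) 260 = 23.4 %; with an ADDITIVE new prime: 0 of 6666 (as the syzygy predicts); on the
3-adic sub-disc `9 ∣ l, 3 ∤ m` (near the Hessian `(0:1)`, box 45, 229 parameters): 111510cj1 57 = 24.9 %, 131760c1
61 = 26.6 %, 137970n1 (−311) 45 = 19.7 %. The census `HESSIAN-TWIN-v1` (pub/bsd-wall) shows why ONE pencil point does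
not suffice: the Hessian alone is `K`-adapted only when every prime of `c₄` splits in `K`.

PIECES (registered stubs = the ONLY `sorry`s; tags in the line card `Lines/heegner_pencil_sieve.md`):
* `stub_ratwall` = item 24207 BY NAME (WEAKER: `ratwall_of_wall`, landed). ATTACKABLE (LEAD line thin_comb).
* `stub_splitValues` : `PrimitiveSplitValuesOfBinaryQuartics` (A1) — pure analytic number theory: an irreducible
  (over `K`), indefinite integral binary quartic with content on `S` has, in every primitive class `mod M`
  (`M` an `S`-unit), infinitely many coprime values all of whose prime factors outside `S` split in `K`.
  ATTACKABLE, size L (plan A: half-dimensional sieve on Daniel's level `X²(log X)^{-A}` — threshold case; plan B: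
  dlBT-type asymptotic for `Σ r_K(F(l,m))` on a class × sector, general `K`, minus the non-squarefree values at inert
  primes via Greaves/Xiao power-free values of binary forms of degree `≤ 5`).
* `stub_pencilDictionary` : `HessePencilDictionaryAtThree` (D1) — the algebraic dictionary: for a cell curve of
  semistable mod-3 type and admissible `K`, one of Fisher's two quartics (`𝔇`: symplectic type, `𝔠₄`:
  anti-symplectic type), `S = {2,3} ∪ primes(N)`, a class `mod 2^j3^k` and the claims «irreducible over `K`,
  indefinite, content on `S`», such that EVERY good parameter in the class gives a `K`-adapted twin of ROUTE CLASS
  at 3 (multiplicative très ramifié ∨ good supersingular `a₃ = 0` ∨ good ordinary). ATTACKABLE·INSTRUMENTABLE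
  (local steps: a semistable mod-3 type is realised 3-adically by a route-class curve — peu ramifié ⇒ also good
  ordinary by Serre–Tate, supersingular `a₃ = ±3 ⇒` also `a₃ = 0` since `ρ̄|G_ℚ₃ ≅ Ind ω₂` is unique; when `2 ∤ N`
  the anti-symplectic pencil has the good 2-adic point `(E/ℚ₂, ψ = Frob₂)`, `det Frob₂ = −1`; Tate's algorithm is
  locally constant; irreducibility over `K` from `ρ̄` onto and `K ≠ ℚ(√−3)`).
* `stub_twinMuOdd` : `TwinTorsionMuZeroOfClassOddAtThree` (T2o) — algebraic `μ = 0` + torsion for route-class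
  twins, `d_K` odd. UNDECIDED: on the two kernel buckets it IS item 24737 `TwinAlgMuZeroAtThree` BY NAME
  (`torsionMuZeroConclusion_of_twinAlgMu`); on the good-ordinary class it is the route's print chain (Hsieh Thm B /
  BCS 2025 Thm 4.2.1(b) / Yan–Zhu 5.7 at `p = 3`).
* `stub_twinMuEven` : `TwinTorsionMuZeroOfClassEvenAtThree` (T2e) — the same for `d_K` even. IDEA-NEEDED (no BDP
  `p`-adic `L`-function in print for even `d_K`; shared by every twin road; `closes` never asks).
* `stub_twinlessCell` : `TwinlessCellTorsionMuZeroAtThree` (T3) — wall contexts with NO semistable mod-3 type.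
  BARRIER for this line (no pencil member is semistable at 3; owned by `cubic_unwinding` / `serre_source_transport`).
* `AdditiveSplitIMCInclusionAtThree_of` : the six stubs ⟹ THE WALL, kernel-checked (no `sorry`), concluding the
  crux BY NAME; compositions `heegnerAdaptedTwinSupply_of` (A1 + D1 ⟹ K-adapted supply T1), `twinSupply_of`
  (T1 + T2o + T2e + T3 ⟹ g6's pointwise supply, restated verbatim), `wall_of_ratwall_of_twinSupply`.

Nothing here is a theorem about elliptic curves beyond compositions of landed results and two polynomial
identities; BSD is not advanced by this file. References: [Fisher2012Hessian] Thm 13.2, §8, §9, §13;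
[RubinSilverberg1995]; de la Bretèche–Tenenbaum, J. Inst. Math. Jussieu 12 (2013) 759–819
(doi:10.1017/S1474748012000886) Thm 1.1–1.2; S. Daniel, J. reine angew. Math. 507 (1999) 107–129;
de la Bretèche–Browning, Acta Arith. 125 (2006) 291–304 (arXiv:math/0604119) and Israel J. Math. 191 (2012)
(arXiv:1006.5859); Greaves, Quart. J. Math. 43 (1992) 45–65; S. Y. Xiao, IMRN 2017 (power-free values of binary
forms); Iwaniec, Acta Arith. 29 (1976) 69–95; [GreenbergVatsal2000] §2; [BurungaleCastellaSkinner2025] Thm 4.2.1(b).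
-/

set_option linter.dupNamespace false
set_option autoImplicit false

noncomputable section

open Polynomial
open NumberField
open Literature.NumberTheory.EllipticCurves
open Literature.NumberTheory.EllipticCurves.ModularForms (ModularParametrizationData)
open Summit.BirchSwinnertonDyer.BirchSwinnertonDyer.Theses.UniversalToricDescent
  (RationalSplitIMCInclusionAtThree AdditiveSplitIMCInclusionAtThree TwinAlgMuZeroAtThree)
open Summit.BirchSwinnertonDyer.BirchSwinnertonDyer.Cruxes.ToricTransportModThree.RatwallThinComb
  (dvd_of_dvd_prime_pow_mul prime_C_three not_C_three_dvd_of_norm_coeff_eq_one)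
open Summit.BirchSwinnertonDyer.BirchSwinnertonDyer.Theorems.UniversalToricDescentTorsionMuTransportHeegner
  (torsionMuTransportModThree)
open Summit.BirchSwinnertonDyer.BirchSwinnertonDyer.Theorems.UniversalToricDescentRationalSplitIMCInclusionAtThreeOfWall
  (rationalSplitIMCInclusionAtThree_of_wall)
open Summit.BirchSwinnertonDyer.Rank1Residual (O6.ModPCongruent O6.HasSemistableModPTypeAt)

namespace Summit.BirchSwinnertonDyer.BirchSwinnertonDyer.Cruxes.AdditiveSplitIMCInclusionAtThree.HeegnerPencilSieve

/-! ## §0 Arithmetic objects: integral binary quartic forms; Fisher's two quartics `𝔇`, `𝔠₄` -/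

/-- An integral binary quartic form `F_a(l,m) = a₀l⁴ + a₁l³m + a₂l²m² + a₃lm³ + a₄m⁴`. [folklore] -/
def binQuartic (a : Fin 5 → ℤ) (l m : ℤ) : ℤ :=
  a 0 * l ^ 4 + a 1 * l ^ 3 * m + a 2 * l ^ 2 * m ^ 2 + a 3 * l * m ^ 3 + a 4 * m ^ 4

/-- Its dehomogenisation `F_a(X,1) ∈ ℤ[X]` (degree 4 when `a₀ ≠ 0`). [folklore] -/
def binQuarticPoly (a : Fin 5 → ℤ) : ℤ[X] :=
  C (a 0) * X ^ 4 + C (a 1) * X ^ 3 + C (a 2) * X ^ 2 + C (a 3) * X + C (a 4)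

/-- Coefficient vector of Fisher's `𝔇(l,m) = l⁴ − 6c₄l²m² − 8c₆lm³ − 3c₄²m⁴` (the cube root of
`Δ(E_{l,m})/(2⁶3⁹Δ′)`; its zeros are the four cusps of `X_E(3)`, its splitting field the `S₄`-field of lines in
`E[3]`). [cite: Fisher2012Hessian, §8 (n = 3)] -/
def hesseDCoeffs (c₄ c₆ : ℤ) : Fin 5 → ℤ := ![1, 0, -(6 * c₄), -(8 * c₆), -(3 * c₄ ^ 2)]

/-- Coefficient vector of Fisher's `𝔠₄(l,m) = c₄l⁴ + 4c₆l³m + 6c₄²l²m² + 4c₄c₆lm³ + (4c₆² − 3c₄³)m⁴` (in the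
tree's parametrisation of the REVERSE pencil, the cube root of `−Δ(E⁻_{l,m})·Δ′⁴/3⁹`, see `Δ_dualHessePencil3`).
[cite: Fisher2012Hessian, §8–§9 (n = 3)] -/
def hesseC4Coeffs (c₄ c₆ : ℤ) : Fin 5 → ℤ :=
  ![c₄, 4 * c₆, 6 * c₄ ^ 2, 4 * c₄ * c₆, 4 * c₆ ^ 2 - 3 * c₄ ^ 3]

/-- DICTIONARY ANCHOR (kernel-checked): `binQuartic (hesseDCoeffs c₄ c₆)` IS the tree's `Fisher2012.hesseD3`
evaluated at `(l, m)`. [cite: Fisher2012Hessian, §8 (n = 3)] -/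
theorem binQuartic_hesseDCoeffs_cast (c₄ c₆ l m : ℤ) :
    ((binQuartic (hesseDCoeffs c₄ c₆) l m : ℤ) : ℚ) =
      MvPolynomial.eval ![(l : ℚ), (m : ℚ)] (Fisher2012.hesseD3 (c₄ : ℚ) (c₆ : ℚ)) := by
  rw [Fisher2012.eval_hesseD3]
  simp only [binQuartic, hesseDCoeffs, Matrix.cons_val]
  push_cast
  ring

/-- DICTIONARY ANCHOR (kernel-checked): `binQuartic (hesseC4Coeffs c₄ c₆)` IS the tree's `Fisher2012.hesseC4three`
(closed form `Fisher2012.eval_hesseC4three`) evaluated at `(l, m)`. [cite: Fisher2012Hessian, §8 (n = 3)] -/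
theorem binQuartic_hesseC4Coeffs_cast (c₄ c₆ l m : ℤ) :
    ((binQuartic (hesseC4Coeffs c₄ c₆) l m : ℤ) : ℚ) =
      MvPolynomial.eval ![(l : ℚ), (m : ℚ)] (Fisher2012.hesseC4three (c₄ : ℚ) (c₆ : ℚ)) := by
  rw [Fisher2012.eval_hesseC4three]
  simp only [binQuartic, hesseC4Coeffs, Matrix.cons_val]
  push_cast
  ring

/-- **Discriminant of the reverse pencil member** (kernel-checked from the tree's definition `dualHessePencil3`
and syzygy `hesse3_syzygy`): `Δ(E⁻_{l,m})·(c₄³ − c₆²)⁴ = −3⁹·𝔠₄(l,m)³`. Hence a prime `p ∤ 6Δ′` is bad for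
`E⁻_{l,m}` only if `p ∣ 𝔠₄(l,m)`. [cite: Fisher2012Hessian, §9 and §13 (the X_E^-(3) family, n = 3)] -/
theorem Δ_dualHessePencil3 (c₄ c₆ l m : ℚ) (hΔ : c₄ ^ 3 - c₆ ^ 2 ≠ 0) :
    (Fisher2012.dualHessePencil3 c₄ c₆ l m).Δ * (c₄ ^ 3 - c₆ ^ 2) ^ 4 =
      -3 ^ 9 * (MvPolynomial.eval ![l, m] (Fisher2012.hesseC4three c₄ c₆)) ^ 3 := by
  obtain ⟨D, hD⟩ : ∃ D, MvPolynomial.eval ![l, m] (Fisher2012.hesseD3 c₄ c₆) = D := ⟨_, rfl⟩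
  obtain ⟨S, hS⟩ : ∃ S, MvPolynomial.eval ![l, m] (Fisher2012.hesseC6three c₄ c₆) = S := ⟨_, rfl⟩
  obtain ⟨Q, hQ⟩ : ∃ Q, MvPolynomial.eval ![l, m] (Fisher2012.hesseC4three c₄ c₆) = Q := ⟨_, rfl⟩
  obtain ⟨u, hu'⟩ : ∃ u, (c₄ ^ 3 - c₆ ^ 2)⁻¹ = u := ⟨_, rfl⟩
  have h : Q ^ 3 - S ^ 2 = (c₄ ^ 3 - c₆ ^ 2) * D ^ 3 := by
    rw [← hD, ← hS, ← hQ]; exact Fisher2012.hesse3_syzygy c₄ c₆ l m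
  have hu : (c₄ ^ 3 - c₆ ^ 2) * u = 1 := by rw [← hu']; exact mul_inv_cancel₀ hΔ
  simp only [Fisher2012.dualHessePencil3, WeierstrassCurve.Δ, WeierstrassCurve.b₂, WeierstrassCurve.b₄,
    WeierstrassCurve.b₆, WeierstrassCurve.b₈, hD, hS, hQ, div_eq_mul_inv, mul_inv, ← inv_pow, hu']
  linear_combination (3 ^ 9 : ℚ) * h
    - (3 ^ 9 : ℚ) * ((c₄ ^ 3 - c₆ ^ 2) * D ^ 3 * (1 + (c₄ ^ 3 - c₆ ^ 2) * u + ((c₄ ^ 3 - c₆ ^ 2) * u) ^ 2)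
        + S ^ 2 * (1 + (c₄ ^ 3 - c₆ ^ 2) * u + ((c₄ ^ 3 - c₆ ^ 2) * u) ^ 2 + ((c₄ ^ 3 - c₆ ^ 2) * u) ^ 3))
        * hu

/-- «`p` splits in `K`» in the tree's idiom of `SatisfiesHeegnerHypothesis`. [folklore] -/
def SplitsIn (K : Type) [Field K] [NumberField K] (p : ℕ) : Prop :=
  ((Ideal.span {(p : ℤ)}).primesOver (𝓞 K)).ncard = 2

/-- A GOOD PARAMETER for `(F_a, S, K)`: coprime `(l, m)` such that every prime outside `S` dividing `F_a(l,m)`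
SPLITS in `K` (inert and ramified primes excluded) — i.e. `F_a(l,m)` is, up to `S`-units, the norm of an ideal of
`𝓞_K` prime to its conjugate. [folklore] -/
def GoodParameter (a : Fin 5 → ℤ) (S : Finset ℕ) (K : Type) [Field K] [NumberField K] (l m : ℤ) : Prop :=
  IsCoprime l m ∧ ∀ p : ℕ, p.Prime → p ∉ S → (p : ℤ) ∣ binQuartic a l m → SplitsIn K p

/-! ## §1 The pieces (Props) -/

/-- **A1 — PRIMITIVE SPLIT VALUES OF BINARY QUARTICS** (pure analytic number theory; the line's first lemma).
For an integral binary quartic form `F` with `F(1,0) ≠ 0`, INDEFINITE, an imaginary quadratic `K` over which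
`F(X,1)` is irreducible, a finite `S ∋ 2, 3` carrying the content of `F`, a modulus `M` supported on `S` and a coprime
pair `(l₀, m₀)`: infinitely many coprime `(l, m) ≡ (l₀, m₀) (mod M)` are good parameters. No local obstruction
(`p ∉ S ⇒ p ≥ 5 > #roots of F mod p`), no reciprocity obstruction (`K` imaginary, `F` indefinite: the sign
`∏_{v ∈ S∪ram∪∞}(d_K, F(l,m))_v` takes both values in every class; for DEFINITE `F` the statement is false, e.g.
`F = l⁴ + 2m⁴`, `K = ℚ(i)`, class `(9,1) mod 24`). Sieve dimension `κ = ½` (Chebotarev: the mean of `ρ_F(p)` over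
inert `p` is 1 as `F` is irreducible over `K`); level of distribution `X²(log X)^{-A}` (Daniel) = the threshold;
nearest print: de la Bretèche–Tenenbaum 2013 Thm 1.1–1.2 (`Σ r_{ℚ(i)}(F(l,m))`, `F` irreducible over `ℚ[i]`).
[cite: doi:10.1017/S1474748012000886, Thm. 1.1] [cite: doi:10.1515/crll.1999.507.107] [cite: arXiv:math/0604119, Thm. 1] -/
def PrimitiveSplitValuesOfBinaryQuartics : Prop :=
  ∀ (a : Fin 5 → ℤ), a 0 ≠ 0 → (∃ x y : ℤ, binQuartic a x y < 0) → (∃ x y : ℤ, 0 < binQuartic a x y) →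
  ∀ (K : Type) [Field K] [NumberField K], IsImaginaryQuadratic K →
    Irreducible ((binQuarticPoly a).map (algebraMap ℤ K)) →
  ∀ (S : Finset ℕ), 2 ∈ S → 3 ∈ S → (∀ p : ℕ, p.Prime → p ∉ S → ∃ i, ¬ (p : ℤ) ∣ a i) →
  ∀ (M : ℕ), 0 < M → (∀ p : ℕ, p.Prime → p ∣ M → p ∈ S) →
  ∀ (l₀ m₀ : ℤ), IsCoprime l₀ m₀ →
    Set.Infinite {lm : ℤ × ℤ | lm.1 ≡ l₀ [ZMOD (M : ℤ)] ∧ lm.2 ≡ m₀ [ZMOD (M : ℤ)] ∧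
      GoodParameter a S K lm.1 lm.2}

/-- The ROUTE'S TWIN CLASS at 3 (after the route's resupplies): multiplicative très ramifié (`3 ∤ v₃Δ_min`), or good
supersingular with `a₃ = 0`, or good ordinary — the three semistable outcomes the route's kernel consumes
(items 24737, 23595/23782 `GoodSSApZeroTwinSupply…`, 27387 `PeuRamifieMultTwinResupplyAtThree`). [folklore] -/
def RouteTwinClassAtThree (W' : WeierstrassCurve ℚ) [W'.IsGloballyMinimal] : Prop :=
  (Rank1Residual.Mult W' 3 ∧ ¬ 3 ∣ padicValInt 3 W'.minimalDiscriminantInt) ∨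
    (Rank1Residual.GoodSS W' 3 ∧ W'.frobeniusTrace 3 = 0) ∨ Rank1Residual.GoodOrd W' 3

/-- **A `K`-ADAPTED TWIN of `W`**: an elliptic, globally minimal `W′/ℚ` with `W′[3] ≅ W[3]`, of route class at 3,
`ρ̄_{W′,3}` onto, with a modular parametrisation of level its conductor `N′`, and `N′` HEEGNER FOR `K` (every prime of
`N′` splits in `K`). [cite: GreenbergVatsal2000, §2] -/
def HeegnerAdaptedTwinAt (W : WeierstrassCurve ℚ) (K : Type) [Field K] [NumberField K] : Prop :=
  ∃ (W' : WeierstrassCurve ℚ) (_ : W'.IsElliptic) (_ : W'.IsGloballyMinimal) (N' : ℕ) (_ : NeZero N'),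
    Nonempty (ModularParametrizationData W' N') ∧ O6.ModPCongruent W' W 3 ∧ RouteTwinClassAtThree W' ∧
      W'.HasSurjectiveModNGaloisRep 3 ∧ W'.conductorNorm ℤ = N' ∧ SatisfiesHeegnerHypothesis N' K

/-- **D1 — THE HESSE-PENCIL DICTIONARY** (algebra/geometry of the two pencils + local constancy; no analysis).
For a cell curve `W` (wild `O6` at 3, `ρ̄₃` onto) of SEMISTABLE mod-3 TYPE, conductor `N`, and `K` imaginary
quadratic Heegner for `N` in which 3 splits: with `c₄, c₆ ∈ ℤ` those of `W`, ONE of Fisher's quartics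
`F ∈ {𝔇, 𝔠₄}` (`𝔇` if the type is realised symplectically by a route-class `ℚ₃`-curve — a `ℚ₃`-point of `X_W(3)`,
`𝔠₄` if anti-symplectically — a point of `X_W⁻(3)`; a peu-ramifié type is also good ordinary (Serre–Tate), a
supersingular type is `Ind ω₂` whatever `a₃ ∈ {0, ±3}`), `S = {2,3} ∪ primes(N)`, a class `mod M = 2^j3^k`
(3-adic disc around that point; 2-adic disc around a good-reduction point when `2 ∤ N` — `(1:0) = W` on `X_W(3)`,
`(W/ℚ₂, Frob₂)` on `X_W⁻(3)`) with a coprime representative, such that: `F(1,0) ≠ 0` (`c₄ ≠ 0` as `j ≠ 0` for onto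
`ρ̄`), `F` is indefinite (complex conjugation is a transposition of the four cusps), `F(X,1)` is irreducible over `K`
(`Gal = S₄`, whose only quadratic subfield is `ℚ(√−3) ≠ K`), the content of `F` lies in `S`, and EVERY good parameter
`(l,m)` of the class yields a `K`-ADAPTED TWIN: the minimal model of `E^±_{l,m}` (`[3]`-congruent to `W` by
Fisher Thm 13.2 / §13, tree-proved; route class at 3 and good at 2 by local constancy of Tate's algorithm; a bad
prime `p ∉ S` divides `F(l,m)` by `Δ_hessePencil3` / `Δ_dualHessePencil3`, hence splits; primes of `N` and 3 split
by hypothesis; modular parametrisation by `nonempty_modularParametrizationData`).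
[cite: Fisher2012Hessian, Thm. 13.2, §8, §9, §13] [cite: RubinSilverberg1995, Thm. 4.1] -/
def HessePencilDictionaryAtThree : Prop :=
  ∀ (W : WeierstrassCurve ℚ) [W.IsElliptic] [W.IsGloballyMinimal] (N : ℕ) [NeZero N] (K : Type) [Field K]
    [NumberField K], Rank1Residual.Additive.ClassO6 W 3 → W.HasSurjectiveModNGaloisRep 3 →
    O6.HasSemistableModPTypeAt W 3 → W.conductorNorm ℤ = N → IsImaginaryQuadratic K →
    SatisfiesHeegnerHypothesis N K →
    ∀ (𝔭 : IsDedekindDomain.HeightOneSpectrum (𝓞 K)), ((3 : ℕ) : 𝓞 K) ∈ 𝔭.asIdeal →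
      𝔭.asIdeal.ramificationIdx (𝓞 ℚ) = 1 → 𝔭.asIdeal.inertiaDeg (𝓞 ℚ) = 1 →
    ∀ (𝔭' : IsDedekindDomain.HeightOneSpectrum (𝓞 K)), ((3 : ℕ) : 𝓞 K) ∈ 𝔭'.asIdeal → 𝔭' ≠ 𝔭 →
    ∃ (c₄ c₆ : ℤ) (a : Fin 5 → ℤ) (S : Finset ℕ) (M : ℕ) (l₀ m₀ : ℤ),
      (c₄ : ℚ) = W.c₄ ∧ (c₆ : ℚ) = W.c₆ ∧ (a = hesseDCoeffs c₄ c₆ ∨ a = hesseC4Coeffs c₄ c₆) ∧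
      S = {2, 3} ∪ N.primeFactors ∧
      a 0 ≠ 0 ∧ (∃ x y : ℤ, binQuartic a x y < 0) ∧ (∃ x y : ℤ, 0 < binQuartic a x y) ∧
      Irreducible ((binQuarticPoly a).map (algebraMap ℤ K)) ∧
      2 ∈ S ∧ 3 ∈ S ∧ (∀ p : ℕ, p.Prime → p ∉ S → ∃ i, ¬ (p : ℤ) ∣ a i) ∧
      0 < M ∧ (∀ p : ℕ, p.Prime → p ∣ M → p ∈ S) ∧ IsCoprime l₀ m₀ ∧
      ∀ (l m : ℤ), l ≡ l₀ [ZMOD (M : ℤ)] → m ≡ m₀ [ZMOD (M : ℤ)] → GoodParameter a S K l m →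
        HeegnerAdaptedTwinAt W K

/-- **T1 — `K`-ADAPTED TWIN SUPPLY on the semistable-type cell** (the statement the lever delivers = A1 + D1,
`heegnerAdaptedTwinSupply_of`): every cell curve of semistable mod-3 type has, for EVERY admissible `K`, a twin of
route class whose conductor is Heegner for that same `K`. Strengthens the tree conjecture `TwinOfSemistableTypeAtThree`
(which asks for one twin, no `K`, no route class). [cite: RubinSilverberg1995, Thm. 4.1] [cite: Fisher2012Hessian, Thm. 13.2] -/
def HeegnerAdaptedTwinSupplyAtThree : Prop :=
  ∀ (W : WeierstrassCurve ℚ) [W.IsElliptic] [W.IsGloballyMinimal] (N : ℕ) [NeZero N] (K : Type) [Field K]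
    [NumberField K], Rank1Residual.Additive.ClassO6 W 3 → W.HasSurjectiveModNGaloisRep 3 →
    O6.HasSemistableModPTypeAt W 3 → W.conductorNorm ℤ = N → IsImaginaryQuadratic K →
    SatisfiesHeegnerHypothesis N K →
    ∀ (𝔭 : IsDedekindDomain.HeightOneSpectrum (𝓞 K)), ((3 : ℕ) : 𝓞 K) ∈ 𝔭.asIdeal →
      𝔭.asIdeal.ramificationIdx (𝓞 ℚ) = 1 → 𝔭.asIdeal.inertiaDeg (𝓞 ℚ) = 1 →
    ∀ (𝔭' : IsDedekindDomain.HeightOneSpectrum (𝓞 K)), ((3 : ℕ) : 𝓞 K) ∈ 𝔭'.asIdeal → 𝔭' ≠ 𝔭 →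
    HeegnerAdaptedTwinAt W K

/-- The common tail of T2o/T2e: `Λ`-torsion of `X_(∅,0)(W′/K_∞)` at `𝔭′` and a generator of `Ch·R₀⟦T⟧` with a
coefficient of 3-adic norm 1 (algebraic `μ = 0`) — item 24737's conclusion verbatim. [cite: GreenbergVatsal2000, §2] -/
def TorsionMuZeroConclusion (W' : WeierstrassCurve ℚ) [W'.IsElliptic] (K : Type) [Field K] [NumberField K]
    (κ : ZpExtension K 3) (𝔭' : IsDedekindDomain.HeightOneSpectrum (𝓞 K)) (γ : Field.absoluteGaloisGroup K)
    [Fact (κ.IsTopGenerator γ)] : Prop :=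
  Module.IsTorsion (IwasawaAlgebra 3) (Rank1Residual.X11b.AcSelmer.XAc (W'.baseChange K) 3 κ 𝔭' ∅ γ) ∧
    ∃ g' : UnrSeries 3,
      (Rank1Residual.X11b.AcSelmer.XAc.charIdeal (W'.baseChange K) 3 κ 𝔭' ∅ γ).map
          (PowerSeries.map (Rank1Residual.X11b.Halves.toUnr 3)) = Ideal.span {g'} ∧
        ∃ i : ℕ, ‖((PowerSeries.coeff i g' : unrIntegers 3) : ℂ_[3])‖ = 1

/-- **T2o — TWIN `μ = 0`, ODD `d_K`**: item 24737's text with its bucket hypothesis widened to the route class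
(très ramifié multiplicative ∨ good-ss `a₃ = 0` ∨ good ordinary). On the first two disjuncts it IS item 24737
(`twinTorsionMuZeroAt_of_twinAlgMu`); the ordinary disjunct is the route's print chain (Hsieh Thm B, BCS 2025
Thm 4.2.1(b), Yan–Zhu Thm 5.7). [cite: BurungaleCastellaSkinner2025, Thm. 4.2.1(b)] [cite: Hsieh2014Documenta, Thm. B] -/
def TwinTorsionMuZeroOfClassOddAtThree : Prop :=
  ∀ (W' : WeierstrassCurve ℚ) [W'.IsElliptic] [W'.IsGloballyMinimal] (N' : ℕ) [NeZero N'] (K : Type) [Field K]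
    [NumberField K] (_Dt' : ModularParametrizationData W' N'),
    RouteTwinClassAtThree W' → W'.HasSurjectiveModNGaloisRep 3 → W'.conductorNorm ℤ = N' →
    IsImaginaryQuadratic K → SatisfiesHeegnerHypothesis N' K → Odd (NumberField.discr K) →
    ∀ (κ : ZpExtension K 3), κ.IsAnticyclotomic →
    ∀ (γ : Field.absoluteGaloisGroup K) [Fact (κ.IsTopGenerator γ)]
      (𝔭 : IsDedekindDomain.HeightOneSpectrum (𝓞 K)), ((3 : ℕ) : 𝓞 K) ∈ 𝔭.asIdeal →
      𝔭.asIdeal.ramificationIdx (𝓞 ℚ) = 1 → 𝔭.asIdeal.inertiaDeg (𝓞 ℚ) = 1 →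
      ∀ (𝔭' : IsDedekindDomain.HeightOneSpectrum (𝓞 K)), ((3 : ℕ) : 𝓞 K) ∈ 𝔭'.asIdeal → 𝔭' ≠ 𝔭 →
        TorsionMuZeroConclusion W' K κ 𝔭' γ

/-- **T2e — TWIN `μ = 0`, EVEN `d_K`**: the same with `¬ Odd (d_K)`. No BDP `p`-adic `L`-function is in print
for even `d_K` (BDP/Castella–Hsieh assume `d_K` odd); the route's `closes` never instantiates this (it chooses `K`
odd), the wall's `∀ K` does. [cite: BurungaleCastellaSkinner2025, Thm. 4.2.1(b) (hypothesis d_K odd)] -/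
def TwinTorsionMuZeroOfClassEvenAtThree : Prop :=
  ∀ (W' : WeierstrassCurve ℚ) [W'.IsElliptic] [W'.IsGloballyMinimal] (N' : ℕ) [NeZero N'] (K : Type) [Field K]
    [NumberField K] (_Dt' : ModularParametrizationData W' N'),
    RouteTwinClassAtThree W' → W'.HasSurjectiveModNGaloisRep 3 → W'.conductorNorm ℤ = N' →
    IsImaginaryQuadratic K → SatisfiesHeegnerHypothesis N' K → ¬ Odd (NumberField.discr K) →
    ∀ (κ : ZpExtension K 3), κ.IsAnticyclotomic →
    ∀ (γ : Field.absoluteGaloisGroup K) [Fact (κ.IsTopGenerator γ)]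
      (𝔭 : IsDedekindDomain.HeightOneSpectrum (𝓞 K)), ((3 : ℕ) : 𝓞 K) ∈ 𝔭.asIdeal →
      𝔭.asIdeal.ramificationIdx (𝓞 ℚ) = 1 → 𝔭.asIdeal.inertiaDeg (𝓞 ℚ) = 1 →
      ∀ (𝔭' : IsDedekindDomain.HeightOneSpectrum (𝓞 K)), ((3 : ℕ) : 𝓞 K) ∈ 𝔭'.asIdeal → 𝔭' ≠ 𝔭 →
        TorsionMuZeroConclusion W' K κ 𝔭' γ

/-- POINTWISE TWIN `μ = 0` DATUM at a wall context — node `ratwall_twin_transport` (g6) VERBATIM (Lines modules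
are not importable): some elliptic `W′` with `W′[3] ≅ W[3]`, conductor `N′` Heegner for the SAME `K`, with
`TorsionMuZeroConclusion`. [cite: GreenbergVatsal2000, §2] -/
def TwinTorsionMuZeroAt (W : WeierstrassCurve ℚ) [W.IsElliptic] (K : Type) [Field K] [NumberField K]
    (κ : ZpExtension K 3) (𝔭' : IsDedekindDomain.HeightOneSpectrum (𝓞 K))
    (γ : Field.absoluteGaloisGroup K) [Fact (κ.IsTopGenerator γ)] : Prop :=
  ∃ (W' : WeierstrassCurve ℚ) (_ : W'.IsElliptic) (N' : ℕ),
    O6.ModPCongruent W' W 3 ∧ W'.conductorNorm ℤ = N' ∧ SatisfiesHeegnerHypothesis N' K ∧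
    Module.IsTorsion (IwasawaAlgebra 3) (Rank1Residual.X11b.AcSelmer.XAc (W'.baseChange K) 3 κ 𝔭' ∅ γ) ∧
    ∃ g' : UnrSeries 3,
      (Rank1Residual.X11b.AcSelmer.XAc.charIdeal (W'.baseChange K) 3 κ 𝔭' ∅ γ).map
          (PowerSeries.map (Rank1Residual.X11b.Halves.toUnr 3)) = Ideal.span {g'} ∧
      ∃ i : ℕ, ‖((PowerSeries.coeff i g' : unrIntegers 3) : ℂ_[3])‖ = 1

/-- THE POINTWISE SUPPLY at every wall context — node `ratwall_twin_transport` (g6) VERBATIM; here it is DERIVED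
(`twinSupply_of`) from T1 + T2o + T2e on the semistable-type cell and from T3 off it. [cite: GreenbergVatsal2000, §2] -/
def TwinTorsionMuZeroSupplyAtThree : Prop :=
  ∀ (W : WeierstrassCurve ℚ) [W.IsElliptic] [W.IsGloballyMinimal] (N : ℕ) [NeZero N] (K : Type) [Field K]
    [NumberField K], Rank1Residual.Additive.ClassO6 W 3 → W.HasSurjectiveModNGaloisRep 3 →
    W.analyticRank = 1 → W.conductorNorm ℤ = N → IsImaginaryQuadratic K → SatisfiesHeegnerHypothesis N K →
    ∀ (κ : ZpExtension K 3), κ.IsAnticyclotomic →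
    ∀ (γ : Field.absoluteGaloisGroup K) [Fact (κ.IsTopGenerator γ)]
      (𝔭 : IsDedekindDomain.HeightOneSpectrum (𝓞 K)), ((3 : ℕ) : 𝓞 K) ∈ 𝔭.asIdeal →
      𝔭.asIdeal.ramificationIdx (𝓞 ℚ) = 1 → 𝔭.asIdeal.inertiaDeg (𝓞 ℚ) = 1 →
      ∀ (𝔭' : IsDedekindDomain.HeightOneSpectrum (𝓞 K)), ((3 : ℕ) : 𝓞 K) ∈ 𝔭'.asIdeal → 𝔭' ≠ 𝔭 →
        TwinTorsionMuZeroAt W K κ 𝔭' γ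

/-- **T3 — THE TWINLESS CELL**: the pointwise supply at wall contexts whose `W[3]|_{G_{ℚ₃}}` has NO semistable
model (no twin at all; a witness of `TwinTorsionMuZeroAt` there is necessarily additive at 3, e.g. `W` itself, so
this IS «torsion ∧ μ = 0 for `W`» on that cell). Not this line's lever. [cite: GreenbergVatsal2000, §2] -/
def TwinlessCellTorsionMuZeroAtThree : Prop :=
  ∀ (W : WeierstrassCurve ℚ) [W.IsElliptic] [W.IsGloballyMinimal] (N : ℕ) [NeZero N] (K : Type) [Field K]
    [NumberField K], Rank1Residual.Additive.ClassO6 W 3 → W.HasSurjectiveModNGaloisRep 3 →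
    ¬ O6.HasSemistableModPTypeAt W 3 →
    W.analyticRank = 1 → W.conductorNorm ℤ = N → IsImaginaryQuadratic K → SatisfiesHeegnerHypothesis N K →
    ∀ (κ : ZpExtension K 3), κ.IsAnticyclotomic →
    ∀ (γ : Field.absoluteGaloisGroup K) [Fact (κ.IsTopGenerator γ)]
      (𝔭 : IsDedekindDomain.HeightOneSpectrum (𝓞 K)), ((3 : ℕ) : 𝓞 K) ∈ 𝔭.asIdeal →
      𝔭.asIdeal.ramificationIdx (𝓞 ℚ) = 1 → 𝔭.asIdeal.inertiaDeg (𝓞 ℚ) = 1 →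
      ∀ (𝔭' : IsDedekindDomain.HeightOneSpectrum (𝓞 K)), ((3 : ℕ) : 𝓞 K) ∈ 𝔭'.asIdeal → 𝔭' ≠ 𝔭 →
        TwinTorsionMuZeroAt W K κ 𝔭' γ

/-! ## §2 Registered leaves (the ONLY `sorry`s) -/

/-- LEAF 0 = route item 24207 `RationalSplitIMCInclusionAtThree` BY NAME (WEAKER than the crux: `ratwall_of_wall`;
ATTACKABLE — LEAD line `thin_comb`). -/
theorem stub_ratwall : RationalSplitIMCInclusionAtThree := by
  sorry

/-- LEAF A1 (ATTACKABLE, analytic number theory, size L; threshold case of the half-dimensional sieve): primitive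
split values of indefinite binary quartics. -/
theorem stub_splitValues : PrimitiveSplitValuesOfBinaryQuartics := by
  sorry

/-- LEAF D1 (ATTACKABLE·INSTRUMENTABLE, algebraic + local constancy, size M–L): the two-pencil dictionary. -/
theorem stub_pencilDictionary : HessePencilDictionaryAtThree := by
  sorry

/-- LEAF T2o (UNDECIDED; = item 24737 on the kernel buckets, print chain on the ordinary class). -/
theorem stub_twinMuOdd : TwinTorsionMuZeroOfClassOddAtThree := by
  sorry

/-- LEAF T2e (IDEA-NEEDED; even `d_K`, shared by every twin road, never asked by `closes`). -/
theorem stub_twinMuEven : TwinTorsionMuZeroOfClassEvenAtThree := by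
  sorry

/-- LEAF T3 (BARRIER for this line: no pencil member is semistable at 3; owned by other lines). -/
theorem stub_twinlessCell : TwinlessCellTorsionMuZeroAtThree := by
  sorry

/-! ## §3 Evidence for the tags (kernel-checked) -/

/-- Tag WEAKER for leaf 0: the crux implies it (landed). -/
theorem ratwall_of_wall : AdditiveSplitIMCInclusionAtThree → RationalSplitIMCInclusionAtThree :=
  rationalSplitIMCInclusionAtThree_of_wall

/-- A route-class twin is semistable at 3 (`¬ Addv`). [folklore] -/
theorem not_addv_of_routeTwinClass (W' : WeierstrassCurve ℚ) [W'.IsGloballyMinimal]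
    (h : RouteTwinClassAtThree W') : ¬ Rank1Residual.Addv W' 3 := by
  rintro ⟨hng, hnm⟩
  rcases h with ⟨hm, -⟩ | ⟨hss, -⟩ | hord
  · exact hnm hm
  · exact hng hss.1
  · exact hng hord.1

/-- SANITY (the type hypothesis of T1/D1 is NECESSARY): a `K`-adapted twin witnesses semistable mod-3 type
(tree: `O6.hasSemistableModPTypeAt_of_twin`). [folklore] -/
theorem hasSemistableModPTypeAt_of_heegnerAdaptedTwinAt (W : WeierstrassCurve ℚ) (K : Type) [Field K]
    [NumberField K] (h : HeegnerAdaptedTwinAt W K) : O6.HasSemistableModPTypeAt W 3 := by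
  obtain ⟨W', _, _, N', _, -, hcong, hclass, -, -, -⟩ := h
  exact Rank1Residual.O6.hasSemistableModPTypeAt_of_twin (W := W) (p := 3) W' hcong
    (not_addv_of_routeTwinClass W' hclass)

/-- CONDUCTOR BOOKKEEPING of the dictionary (kernel-checked logic): if every prime of `N′` divides `N`, or splits
in `K` outright (the prime 3), or lies outside `S` and divides `F(l,m)`, then a good parameter makes `N′` Heegner
for `K`. [folklore] -/
theorem satisfiesHeegnerHypothesis_of_primeSupport (N N' : ℕ) (K : Type) [Field K] [NumberField K]
    (a : Fin 5 → ℤ) (S : Finset ℕ) (l m : ℤ) (hH : SatisfiesHeegnerHypothesis N K)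
    (hgood : GoodParameter a S K l m)
    (hsupp : ∀ p : ℕ, p.Prime → p ∣ N' → p ∣ N ∨ SplitsIn K p ∨ (p ∉ S ∧ (p : ℤ) ∣ binQuartic a l m)) :
    SatisfiesHeegnerHypothesis N' K := by
  intro p hp hpN'
  rcases hsupp p hp hpN' with h | h | ⟨hS, hdvd⟩
  · exact hH p hp h
  · exact h
  · exact hgood.2 p hp hS hdvd

/-- A good parameter is in particular UNOBSTRUCTED: no prime outside `S` dividing `F(l,m)` is inert or ramified,
so the reciprocity sign `∏_{p ∉ S} χ_K(p)^{v_p F(l,m)}` is `+1` (here: the set of offending primes is empty).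
[folklore] -/
theorem no_nonsplit_prime_of_goodParameter (a : Fin 5 → ℤ) (S : Finset ℕ) (K : Type) [Field K] [NumberField K]
    (l m : ℤ) (h : GoodParameter a S K l m) :
    {p : ℕ | p.Prime ∧ p ∉ S ∧ (p : ℤ) ∣ binQuartic a l m ∧ ¬ SplitsIn K p} = ∅ := by
  ext p
  simp only [Set.mem_setOf_eq, Set.mem_empty_iff_false, iff_false, not_and, not_not]
  exact fun hp hS hdvd => h.2 p hp hS hdvd

/-- **T2o on the kernel buckets IS item 24737** `TwinAlgMuZeroAtThree` BY NAME (node g6's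
`twinTorsionMuZeroAt_of_twinAlgMu`, re-checked here). -/
theorem torsionMuZeroConclusion_of_twinAlgMu (hA : TwinAlgMuZeroAtThree)
    (W' : WeierstrassCurve ℚ) [W'.IsElliptic] [W'.IsGloballyMinimal] (N' : ℕ) [NeZero N'] (K : Type) [Field K]
    [NumberField K] (Dt' : ModularParametrizationData W' N')
    (hbucket : Rank1Residual.Mult W' 3 ∧ ¬ 3 ∣ padicValInt 3 W'.minimalDiscriminantInt ∨
      Rank1Residual.GoodSS W' 3 ∧ W'.frobeniusTrace 3 = 0)
    (hsurj' : W'.HasSurjectiveModNGaloisRep 3) (hN' : W'.conductorNorm ℤ = N') (hK : IsImaginaryQuadratic K)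
    (hH' : SatisfiesHeegnerHypothesis N' K) (hodd : Odd (NumberField.discr K))
    (κ : ZpExtension K 3) (hκ : κ.IsAnticyclotomic) (γ : Field.absoluteGaloisGroup K) [Fact (κ.IsTopGenerator γ)]
    (𝔭 : IsDedekindDomain.HeightOneSpectrum (𝓞 K)) (h3 : ((3 : ℕ) : 𝓞 K) ∈ 𝔭.asIdeal)
    (he : 𝔭.asIdeal.ramificationIdx (𝓞 ℚ) = 1) (hf : 𝔭.asIdeal.inertiaDeg (𝓞 ℚ) = 1)
    (𝔭' : IsDedekindDomain.HeightOneSpectrum (𝓞 K)) (h3' : ((3 : ℕ) : 𝓞 K) ∈ 𝔭'.asIdeal) (hne : 𝔭' ≠ 𝔭) :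
    TorsionMuZeroConclusion W' K κ 𝔭' γ :=
  hA W' N' K Dt' hbucket hsurj' hN' hK hH' hodd κ hκ γ 𝔭 h3 he hf 𝔭' h3' hne

/-! ## §4 Compositions (kernel-checked, no `sorry`) -/

/-- **A1 + D1 ⟹ T1**: the dictionary names the class, the analytic lemma populates it (an infinite set is
nonempty), the dictionary turns any good parameter into a `K`-adapted twin. [folklore] -/
theorem heegnerAdaptedTwinSupply_of :
    PrimitiveSplitValuesOfBinaryQuartics → HessePencilDictionaryAtThree → HeegnerAdaptedTwinSupplyAtThree := by
  intro hA hD W _ _ N _ K _ _ hO6 hsurj hty hN hK hH 𝔭 h3 he hf 𝔭' h3' hne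
  obtain ⟨c₄, c₆, a, S, M, l₀, m₀, -, -, -, -, ha0, hneg, hpos, hirr, h2, h3S, hcont, hM, hMS, hcop, hall⟩ :=
    hD W N K hO6 hsurj hty hN hK hH 𝔭 h3 he hf 𝔭' h3' hne
  have hinf := hA a ha0 hneg hpos K hK hirr S h2 h3S hcont M hM hMS l₀ m₀ hcop
  obtain ⟨⟨l, m⟩, hl, hm, hgood⟩ := hinf.nonempty
  exact hall l m hl hm hgood

/-- **T1 + T2o + T2e + T3 ⟹ the pointwise supply** (excluded middle on the mod-3 type and on the parity of `d_K`).
[folklore] -/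
theorem twinSupply_of :
    HeegnerAdaptedTwinSupplyAtThree → TwinTorsionMuZeroOfClassOddAtThree → TwinTorsionMuZeroOfClassEvenAtThree →
      TwinlessCellTorsionMuZeroAtThree → TwinTorsionMuZeroSupplyAtThree := by
  intro hT1 hTo hTe hT3 W _ _ N _ K _ _ hO6 hsurj hr1 hN hK hH κ hκ γ _ 𝔭 h3 he hf 𝔭' h3' hne
  by_cases hty : O6.HasSemistableModPTypeAt W 3
  · obtain ⟨W', _, _, N', _, ⟨Dt'⟩, hcong, hclass, hsurj', hN', hH'⟩ :=
      hT1 W N K hO6 hsurj hty hN hK hH 𝔭 h3 he hf 𝔭' h3' hne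
    have hconc : TorsionMuZeroConclusion W' K κ 𝔭' γ := by
      by_cases hodd : Odd (NumberField.discr K)
      · exact hTo W' N' K Dt' hclass hsurj' hN' hK hH' hodd κ hκ γ 𝔭 h3 he hf 𝔭' h3' hne
      · exact hTe W' N' K Dt' hclass hsurj' hN' hK hH' hodd κ hκ γ 𝔭 h3 he hf 𝔭' h3' hne
    obtain ⟨hT', hg'⟩ := hconc
    exact ⟨W', ‹W'.IsElliptic›, N', hcong, hN', hH', hT', hg'⟩
  · exact hT3 W N K hO6 hsurj hty hr1 hN hK hH κ hκ γ 𝔭 h3 he hf 𝔭' h3' hne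

/-- **Pointwise supply + RATWALL ⟹ THE WALL** — node g6's composition re-checked: transport torsion and `μ = 0`
from the `K`-adapted twin to `W` along `W′[3] ≅ W[3]` (`torsionMuTransportModThree`, landed; it is HERE that the
two Heegner hypotheses for the same `K` are consumed), then 3-saturate `3^k·L ∈ (g)` in the domain `R₀⟦T⟧`.
[folklore] -/
theorem wall_of_ratwall_of_twinSupply :
    RationalSplitIMCInclusionAtThree → TwinTorsionMuZeroSupplyAtThree → AdditiveSplitIMCInclusionAtThree := by
  intro hR hS W _ _ N _ K _ _ Dt hO6 hsurj hr1 hN hK hH κ hκ γ _ 𝔭 h3 he hf 𝔭' h3' hne ι' hι ΩK Ωp L hΩK hΩp hL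
  obtain ⟨k, hk⟩ := hR W N K Dt hO6 hsurj hr1 hN hK hH κ hκ γ 𝔭 h3 he hf 𝔭' h3' hne ι' hι ΩK Ωp L hΩK hΩp hL
  obtain ⟨W', _, N', hcong, hN', hH', hT', hg'⟩ := hS W N K hO6 hsurj hr1 hN hK hH κ hκ γ 𝔭 h3 he hf 𝔭' h3' hne
  obtain ⟨-, g, hg, i, hi⟩ := torsionMuTransportModThree W W' K hN hcong hN' hK hH hH' κ hκ γ 𝔭' h3' hT' hg'
  rw [hg] at hk ⊢
  have hdvd : g ∣ ((3 : ℕ) : UnrSeries 3) ^ k * L := Ideal.mem_span_singleton.mp hk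
  rw [← map_natCast (PowerSeries.C (R := unrIntegers 3))] at hdvd
  exact Ideal.span_singleton_le_span_singleton.mpr
    (dvd_of_dvd_prime_pow_mul prime_C_three (not_C_three_dvd_of_norm_coeff_eq_one hi) k hdvd)

/-- **THE CRUX FROM THE REGISTERED STUBS** (concludes `AdditiveSplitIMCInclusionAtThree` BY NAME):
RATWALL (24207) + A1 (split values of binary quartics) + D1 (two-pencil dictionary) + T2o/T2e (twin `μ = 0` by parity of `d_K`)
+ T3 (twinless cell) ⟹ THE WALL. [folklore] -/
theorem AdditiveSplitIMCInclusionAtThree_of :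
    RationalSplitIMCInclusionAtThree → PrimitiveSplitValuesOfBinaryQuartics → HessePencilDictionaryAtThree →
      TwinTorsionMuZeroOfClassOddAtThree → TwinTorsionMuZeroOfClassEvenAtThree →
      TwinlessCellTorsionMuZeroAtThree → AdditiveSplitIMCInclusionAtThree :=
  fun hR hA hD hTo hTe hT3 =>
    wall_of_ratwall_of_twinSupply hR (twinSupply_of (heegnerAdaptedTwinSupply_of hA hD) hTo hTe hT3)

/-- The crux from the six registered stubs, as a closed term (audit: its only `sorry`s are the stubs'). -/
theorem wall_from_stubs : AdditiveSplitIMCInclusionAtThree :=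
  AdditiveSplitIMCInclusionAtThree_of stub_ratwall stub_splitValues stub_pencilDictionary stub_twinMuOdd
    stub_twinMuEven stub_twinlessCell

end Summit.BirchSwinnertonDyer.BirchSwinnertonDyer.Cruxes.AdditiveSplitIMCInclusionAtThree.HeegnerPencilSieve

end
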